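import Mathlib
import HarnessLib
import Literature.Analysis.FluidPDE.TypeIAncientMild
import Summits.NavierStokesRegularity.NavierStokesRegularity.Theorems.QuarterLogPincerTruncationEdgeDefs

/-!
# Route `QuarterLogPincer`, crux `TypeIQuantSubcubicExp` (stmt-NavierStokesRegularity-24077): THE OBJECTS OF LINE
# `quiet_core` §1 (ns-idea-7 g10), RE-HOMED VERBATIM UNDER `Theorems/`

Line `Cruxes/TypeIQuantSubcubicExp/Lines/quiet_core.lean` (ns-idea-7 g10; v1.5, tree sha12 d1a96bf31391; critic of record
idea-crit-4 g6: PASS) declares its §1 objects in the namespace `…Cruxes.TypeIQuantSubcubicExp.QuietCore`.  A line file cannot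
be imported from `Theorems/`, so — exactly as for line `quiet_collar` (`…QuietCollarDefs.lean`) — this module re-homes the
§1 OBJECTS verbatim (same namespace, same names, same bodies; docstrings the line's): `CubeBudgetWith` (+ `envelopeCubeBudget_iff`,
`CubeBudgetWith.envelopeCubeBudget`, `CubeBudgetWith.mono`), `QuietCore`, `StubQuietCore`, `SubcriticalUpgrade`,
`StubSubcriticalUpgrade`, `BudgetPass`, `StubBudgetPass`, so that the line can import it and delete its copies, and so that the
PROVED lever S4♭ `stub_budgetPass : StubBudgetPass` (`…QuietCoreBudgetPass.lean`) is a tree theorem BY NAME.  The sorried stub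
S3♭ `stub_subcriticalUpgrade` is NOT re-homed (it stays the line's registered open stub).  No `Theses` import (theses-cone clean).
HONEST FRAME: definitions about HYPOTHETICAL Type-I ancient mild fields with a log-cube budget; nothing here bears on 24077, W7
or Navier–Stokes regularity (OPEN).  Port by the pub-ns-dss typer (g36) on DIRECTOR-NS KEY-NS #181/#182.
-/

noncomputable section

set_option linter.dupNamespace false

namespace Summit.NavierStokesRegularity.NavierStokesRegularity.Cruxes.TypeIQuantSubcubicExp.QuietCore

open MeasureTheory Set Function Metric Filter Topology
open scoped ENNReal NNReal
open Literature.Analysis Literature.Analysis.FluidPDE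
open Summit.NavierStokesRegularity.NavierStokesRegularity.Cruxes.TypeIQuantSubcubicExp.TruncationEdge

/-- The log-cube budget of `EnvelopeCubeBudget` with its constant `B` EXPOSED:
`‖v(s)‖³_{L³(B(0,R))} ≤ B·(1 + log R + log(1/ε))` for `s ∈ [−1,−ε]`, `R ≥ 2`, `ε ∈ (0,1]`. -/
def CubeBudgetWith (B : ℝ) (v : ℝ → EuclideanSpace ℝ (Fin 3) → EuclideanSpace ℝ (Fin 3)) : Prop :=
  0 ≤ B ∧ ∀ R : ℝ, 2 ≤ R → ∀ ε ∈ Set.Ioc (0 : ℝ) 1, ∃ b : ℝ, 0 ≤ b ∧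
    b ^ 3 ≤ B * (1 + Real.log R + Real.log (1 / ε)) ∧
    ∀ s ∈ Set.Icc (-1 : ℝ) (-ε),
      eLpNorm ((Metric.ball (0 : EuclideanSpace ℝ (Fin 3)) R).indicator (v s)) 3 volume ≤
        ENNReal.ofReal b

/-- `EnvelopeCubeBudget v ↔ ∃ B, CubeBudgetWith B v`. [line quiet_core §1, verbatim] -/
theorem envelopeCubeBudget_iff (v : ℝ → EuclideanSpace ℝ (Fin 3) → EuclideanSpace ℝ (Fin 3)) :
    EnvelopeCubeBudget v ↔ ∃ B : ℝ, CubeBudgetWith B v := by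
  unfold EnvelopeCubeBudget CubeBudgetWith
  constructor
  · rintro ⟨B, hB, h⟩; exact ⟨B, hB, h⟩
  · rintro ⟨B, hB, h⟩; exact ⟨B, hB, h⟩

/-- A budget with constant `B` is an `EnvelopeCubeBudget`. [line quiet_core §1, verbatim] -/
theorem CubeBudgetWith.envelopeCubeBudget {B : ℝ} {v : ℝ → EuclideanSpace ℝ (Fin 3) → EuclideanSpace ℝ (Fin 3)}
    (h : CubeBudgetWith B v) : EnvelopeCubeBudget v :=
  (envelopeCubeBudget_iff v).2 ⟨B, h⟩

/-- The budget is monotone in its constant. -/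
theorem CubeBudgetWith.mono {B B' : ℝ} {v : ℝ → EuclideanSpace ℝ (Fin 3) → EuclideanSpace ℝ (Fin 3)}
    (h : CubeBudgetWith B v) (hBB' : B ≤ B') : CubeBudgetWith B' v := by
  refine ⟨h.1.trans hBB', fun R hR ε hε => ?_⟩
  obtain ⟨b, hb0, hb3, hsl⟩ := h.2 R hR ε hε
  refine ⟨b, hb0, hb3.trans ?_, hsl⟩
  have hlog : 0 ≤ 1 + Real.log R + Real.log (1 / ε) := by
    have h1 : 0 ≤ Real.log R := Real.log_nonneg (by linarith)
    have h2 : 0 ≤ Real.log (1 / ε) :=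
      Real.log_nonneg (by rw [le_div_iff₀ hε.1]; linarith [hε.2])
    linarith
  exact mul_le_mul_of_nonneg_right hBB' hlog

/-- **QUIET-CORE PROPAGATION** (QC, the statement the loop consumes).  For the Type-I ancient mild class with
constant `M` and log-cube budget constant `B` there are a quiet level `c₀ > 0`, a late time `s₁ < 0` and a bound `K`
such that: if at some `s ∈ [s₁, 0)` the field is quiet on the unit core, `‖v(s,x)‖ ≤ c₀/√(−s)` for `|x| < 1`, then
`‖v(t,x)‖ ≤ K/√(−s)` for all `t ∈ [s,0)`, `|x| < 1/2` — the quiet core survives to the apex.  DERIVED below from the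
two registered stubs S3♭ (subcritical upgrade, budget-free) and S4♭ (one budget-capped Oseen pass). -/
def QuietCore (M B : ℝ) : Prop :=
  ∃ c₀ s₁ K : ℝ, 0 < c₀ ∧ s₁ < 0 ∧ 0 ≤ K ∧
    ∀ v : ℝ → EuclideanSpace ℝ (Fin 3) → EuclideanSpace ℝ (Fin 3),
      IsTypeIAncientMild M v → CubeBudgetWith B v →
      ∀ s ∈ Set.Ico s₁ 0,
        (∀ x ∈ Metric.ball (0 : EuclideanSpace ℝ (Fin 3)) 1, ‖v s x‖ ≤ c₀ / Real.sqrt (-s)) →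
        ∀ t ∈ Set.Ico s 0, ∀ x ∈ Metric.ball (0 : EuclideanSpace ℝ (Fin 3)) (1 / 2),
          ‖v t x‖ ≤ K / Real.sqrt (-s)

/-- QC for every `(M, B)` (a `def`, not a stub: see `stubQuietCore_of`). -/
def StubQuietCore : Prop := ∀ M B : ℝ, QuietCore M B

/-- **S3♭ · SUBCRITICAL UPGRADE (budget-free; the TRANSPLANT).**  For the Type-I ancient mild class with constant `M`:
a `c₀/√(−s)`-quiet unit core at a late time `s ∈ [s₁,0)` is SUBCRITICAL afterwards on `B(0,3/4)`:
`‖v(t,x)‖ ≤ 4c₀·(−s)^{−3/8}(−t)^{−1/8}` for `t ∈ [s,0)`.  This is `stub_quietDecayUpgrade` (S3) of the tree line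
`Cruxes/TypeIConcentration/Lines/quiet-point-subcritical-upgrade.lean` (crux 2881, Clay class, 2026-08-16; triage
pass ×3, unproved, not the picked line) transplanted VERBATIM to the ancient mild class with `ν = 1`, `T = 0`, quiet
radius `1 ≥ ρ(M)√(−s)` (i.e. `s₁ = −ρ(M)⁻²/16`) and centres `x₀ ∈ B(0,3/4)`; here the Oseen representation (their S1)
is free (`IsTypeIAncientMild.mild_eq_oseenKernel`) and no energy is used.  Mechanism: self-improving shielded Oseen
bootstrap; the Type-I far field's log-divergent drift `(M²/d)·log((−s)/(−t))` is absorbed by the allowed growth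
`((−s)/(−t))^{1/8}` once `ρ(M) ≳ M²/c₀`. -/
def SubcriticalUpgrade (M : ℝ) : Prop :=
  ∃ c₀ s₁ : ℝ, 0 < c₀ ∧ s₁ < 0 ∧
    ∀ v : ℝ → EuclideanSpace ℝ (Fin 3) → EuclideanSpace ℝ (Fin 3), IsTypeIAncientMild M v →
      ∀ s ∈ Set.Ico s₁ 0,
        (∀ x ∈ Metric.ball (0 : EuclideanSpace ℝ (Fin 3)) 1, ‖v s x‖ ≤ c₀ / Real.sqrt (-s)) →
        ∀ t ∈ Set.Ico s 0, ∀ x ∈ Metric.ball (0 : EuclideanSpace ℝ (Fin 3)) (3 / 4),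
          ‖v t x‖ ≤ 4 * c₀ * (-s) ^ (-(3 / 8 : ℝ)) * (-t) ^ (-(1 / 8 : ℝ))

/-- Stub S3♭ (REGISTERED, HARDEST): the subcritical upgrade for every `M`. -/
def StubSubcriticalUpgrade : Prop := ∀ M : ℝ, SubcriticalUpgrade M

/-- **S4♭ · THE BUDGET PASS (the NEW lever: the log-cube budget replaces the energy).**  For the class with constants
`(M, B)` and any level `c₀ > 0` there are `s₂ < 0` and `K ≥ 0` such that a field which is subcritical on
`[s,0) × B(0,3/4)` in the sense of S3♭ (`s ∈ [s₂,0)`) is BOUNDED by `K/√(−s)` on `[s,0) × B(0,1/2)`.  A LINEAR estimate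
(no bootstrap): in the Oseen representation from time `s`, the heat part is `≤ 4c₀/√(−s) + (M/√(−s))e^{−1/(128(−s))}`,
the near Duhamel part (`|y−x| < 1/4`, hypothesis) is `≤ 16c₀²(−s)^{−3/4}∫_s^t (t−τ)^{−1/2}(−τ)^{−1/4}dτ ≤ C c₀²/√(−s)`,
and the far part (`|y−x| ≥ 1/4`, EVERY `y`) is bounded by Hölder `L³–L^{3/2}` — `‖∇O(σ)‖_{L³(|z|>1/4)} ≲ 4³` against the
slice budgets `b_R(τ)³ ≤ B(1+log R+log(1/(−τ)))` in dyadic shells — by `C·B^{2/3}∫_s^0 (2+log(1/(−τ)))^{2/3}dτ → 0`: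
TIME-INTEGRABLE, which is exactly what the pointwise Type-I far field is not (`∫ M²/(−τ) dτ = ∞`; this is where the
Clay-class line S4 `stub_quietImpliesRegular` spends the ENERGY instead). -/
def BudgetPass (M B : ℝ) : Prop :=
  ∀ c₀ : ℝ, 0 < c₀ → ∃ s₂ K : ℝ, s₂ < 0 ∧ 0 ≤ K ∧
    ∀ v : ℝ → EuclideanSpace ℝ (Fin 3) → EuclideanSpace ℝ (Fin 3),
      IsTypeIAncientMild M v → CubeBudgetWith B v →
      ∀ s ∈ Set.Ico s₂ 0,
        (∀ t ∈ Set.Ico s 0, ∀ x ∈ Metric.ball (0 : EuclideanSpace ℝ (Fin 3)) (3 / 4),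
          ‖v t x‖ ≤ 4 * c₀ * (-s) ^ (-(3 / 8 : ℝ)) * (-t) ^ (-(1 / 8 : ℝ))) →
        ∀ t ∈ Set.Ico s 0, ∀ x ∈ Metric.ball (0 : EuclideanSpace ℝ (Fin 3)) (1 / 2),
          ‖v t x‖ ≤ K / Real.sqrt (-s)

/-- Stub S4♭ (REGISTERED, M-sized, the lever proper): the budget pass for every `(M, B)`. -/
def StubBudgetPass : Prop := ∀ M B : ℝ, BudgetPass M B



end Summit.NavierStokesRegularity.NavierStokesRegularity.Cruxes.TypeIQuantSubcubicExp.QuietCore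

end
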